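/-
COR-CM (cell pub-hodgecm2, stage 2 of the Hodge ladder) — X_Γ-side junction «THE RANGE HYPOTHESIS HOLDS AT `P_Γ`»: for every
ANISOTROPIC Picard code `c` the realised Picard modular surface `P_c = Var.scheme hU h₃ (.pms c)` of the model universe — a
compact ball quotient, `Var.ballDatum hU h₃ c h` — satisfies ISO(`P_c`): `(f^P)^* : H¹(Alb P_c(ℂ); ℚ) ≅ H¹(P_c(ℂ); ℚ)` for every
Albanese datum and base point, `2 dim Alb P_c = b₁(P_c)`, `dim Alb P_c = q(P_c)`; hence `Motives/AlbaneseHodgeBlockReach`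
(p260683) applies RANGE-FREE at `P_c`.  Written by the binder seat pub-hodgecm2-b10 (prover-pub-hodgecm2-b10-g19-0),
count-neutral own lane ALB-H1-ISO (plan `HOME/pub-hodgecm2-b10/gen18/ALB-H1-ISO-PLAN.md`), over its Literature chain
`ShimuraVarieties/UnitaryBall{ClassLiftClosed, FundamentalGroup, PeriodLattice, PeriodLatticeSpan, AlbaneseMap, AlbaneseHodge,
AlbaneseAbelianVariety, AlbaneseAlgebraic}` (the analytic Albanese `P_c → ℂ^q/Λ`, algebraised by GAGA).  Theorems only;
nothing cited as a record (the record `Arapura2012_Cor_15_4_6` is DISCHARGED by the tree theorem `arapura2012_cor_15_4_6_holds`,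
as in `B01/LevelCovering`); nothing asserted; no binder row touched; nothing under `CorCM/B01/` edited or restated; not a
display of record; the wording of record is unchanged.
-/
import Summits.HodgeConjecture.CorCM.Model.Universe
import Literature.AlgebraicGeometry.ShimuraVarieties.UnitaryBallAlbaneseAlgebraic
import Literature.AlgebraicGeometry.Motives.AlbaneseHodgeBlockReach
import HarnessLib

/-!
# The Albanese range hypothesis at the Picard modular surfaces of the model universe

ON THE MODEL UNIVERSE over `(hU : BallQuotientUniformisedDatum, h₃ : CMAbelianVarietyRealised)`: the realised Picard
modular surface `P_c = Var.scheme hU h₃ (.pms c)` of an anisotropic code `c` (every `pmsCode L ι₁ V Γ` with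
`[L : ℚ] > 2`, `PicardCode.isAnisotropic_of_two_lt`) carries the ball datum `Var.ballDatum hU h₃ c h`, so the
Literature theorems of `ShimuraVarieties/UnitaryBallAlbaneseAlgebraic` apply to it verbatim:

* `exists_abelianVariety_bijective_bettiCohomology_map_pms` — some morphism `φ : P_c ⟶ B` to an abelian variety of
  dimension `q(P_c)` is bijective on `H¹(−(ℂ); ℚ)` (the algebraised analytic Albanese);
* **`isIso_bettiCohomology_map_abelJacobi_pms`** — ISO(`P_c`): for every Albanese datum `𝒥 : Jacobian P_c` and every
  `P ∈ P_c(ℂ)`, `(f^P)^*` is an isomorphism `H¹(Alb P_c(ℂ); ℚ) ≅ H¹(P_c(ℂ); ℚ)`;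
* **`finrank_bettiCohomology_le_two_mul_dim_pms`** — `b₁(P_c) ≤ 2 dim Alb P_c`, the RANGE hypothesis `hb` of
  `Jacobian.exists_cmType_hom_ne_zero_of_allOrNothing_submodule_of_finrank_le`; `two_mul_dim_eq_finrank_bettiCohomology_pms`,
  `jacobian_dim_eq_finrank_hodgeOneZero_pms` (`dim Alb P_c = q(P_c)`, [Liu2021] Lemma 2.4 (1) — PROVED here, cited as provenance);
* **`exists_cmType_hom_ne_zero_of_allOrNothing_submodule_pms`** — p260683 RANGE-FREE at `P_c`: every non-zero
  all-or-nothing `K`-block `W ⊆ H¹(P_c(ℂ); ℚ)` makes `Alb P_c` reach the CM abelian varieties of the type read off the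
  block, through morphisms `P_c → A` non-zero on `H¹` with image inside `W`.
-/

noncomputable section

open scoped TensorProduct
open CategoryTheory Module NumberField

namespace Summit.HodgeConjecture.CorCM

open Literature.AlgebraicGeometry.Motives
open Literature.AlgebraicGeometry.HodgeTheory
open Literature.AlgebraicGeometry.HodgeTheory.BettiUniverse (IsInducedOnIntegers)
open Literature.AlgebraicGeometry.ComplexMultiplication (IsCMTypeRealisation)
open Literature.NumberTheory.Automorphic.PicardCM

namespace Model

variable {hU : BallQuotientUniformisedDatum} {h₃ : CMAbelianVarietyRealised} (c : PicardCode) (h : c.IsAnisotropic)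
include h

/-- **Some morphism from `P_c` to an abelian variety of dimension `q(P_c)` is bijective on `H¹(−(ℂ); ℚ)`** (the
algebraised analytic Albanese of the compact ball quotient `P_c`,
`UnitaryBallUniformisationDatum.exists_abelianVariety_surjective_bettiCohomology_map` on `Var.ballDatum`, the record
`Arapura2012_Cor_15_4_6` discharged by `arapura2012_cor_15_4_6_holds`). -/
theorem exists_abelianVariety_bijective_bettiCohomology_map_pms :
    ∃ (B : AbelianVariety ℂ) (φ : Var.scheme hU h₃ (.pms c) ⟶ B.X),
      B.dim = finrank ℂ (hodgeOneZero (Var.isSmoothProjective hU h₃ (.pms c))) ∧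
        Function.Bijective (bettiCohomology.map φ 1) :=
  (Var.ballDatum hU h₃ c h).exists_abelianVariety_surjective_bettiCohomology_map

/-- **ISO(`P_c`)**: for every Albanese datum `𝒥` of `P_c` and every base point, `(f^P)^* : H¹(Alb P_c(ℂ); ℚ) → H¹(P_c(ℂ); ℚ)`
is an isomorphism (`UnitaryBallUniformisationDatum.isIso_bettiCohomology_map_abelJacobi`). -/
theorem isIso_bettiCohomology_map_abelJacobi_pms (𝒥 : Jacobian (Var.scheme hU h₃ (.pms c)))
    (P : AlgPoints (Var.scheme hU h₃ (.pms c)) ℂ) : IsIso (bettiCohomology.map (𝒥.abelJacobi P) 1) :=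
  (Var.ballDatum hU h₃ c h).isIso_bettiCohomology_map_abelJacobi 𝒥 P

/-- **`b₁(P_c) ≤ 2 dim Alb P_c`** — the RANGE hypothesis `hb` of
`Jacobian.exists_cmType_hom_ne_zero_of_allOrNothing_submodule_of_finrank_le` at `P_c`. -/
theorem finrank_bettiCohomology_le_two_mul_dim_pms (𝒥 : Jacobian (Var.scheme hU h₃ (.pms c))) :
    finrank ℚ (bettiCohomology (Var.scheme hU h₃ (.pms c)) 1) ≤ 2 * 𝒥.J.dim :=
  (Var.ballDatum hU h₃ c h).finrank_bettiCohomology_le_two_mul_dim 𝒥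

/-- **`2 dim Alb P_c = b₁(P_c)`.** -/
theorem two_mul_dim_eq_finrank_bettiCohomology_pms (𝒥 : Jacobian (Var.scheme hU h₃ (.pms c))) :
    2 * 𝒥.J.dim = finrank ℚ (bettiCohomology (Var.scheme hU h₃ (.pms c)) 1) :=
  (Var.ballDatum hU h₃ c h).two_mul_dim_eq_finrank_bettiCohomology 𝒥

/-- **`dim Alb P_c = q(P_c) = h^{1,0}(P_c)`** ([Liu2021] Lemma 2.4 (1) at the realised Picard modular surface, PROVED). -/
theorem jacobian_dim_eq_finrank_hodgeOneZero_pms (𝒥 : Jacobian (Var.scheme hU h₃ (.pms c))) :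
    𝒥.J.dim = finrank ℂ (hodgeOneZero (Var.isSmoothProjective hU h₃ (.pms c))) :=
  (Var.ballDatum hU h₃ c h).jacobian_dim_eq_finrank_hodgeOneZero 𝒥

/-- **p260683 RANGE-FREE at `P_c`.**  For every Albanese datum `𝒥` of `P_c`, `P ∈ P_c(ℂ)`, and every non-zero `ℚ`-block
`W ⊆ H¹(P_c(ℂ); ℚ)` with an action `ρ` of a number field `K` whose complexified joint `σ`-eigenvectors are, for every `σ`,
ALL of type `(1,0)` or ALL of type `(0,1)` on `P_c`: there is a CM type `Φ` of `K` (the `σ` with eigenvectors of type `(1,0)`)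
such that every realisation `(A, ι, θ)` of `(K; Φ)` receives a homomorphism `u : Alb P_c → A`, `u ≠ 0`, with `u ∘ f^P`
non-zero on `H¹(−(ℂ); ℚ)` and `(u ∘ f^P)^* H¹(A(ℂ); ℚ) ⊆ W`
(`Jacobian.exists_cmType_hom_ne_zero_of_allOrNothing_submodule_of_finrank_le` with `finrank_bettiCohomology_le_two_mul_dim_pms`). -/
theorem exists_cmType_hom_ne_zero_of_allOrNothing_submodule_pms (𝒥 : Jacobian (Var.scheme hU h₃ (.pms c)))
    (P : AlgPoints (Var.scheme hU h₃ (.pms c)) ℂ) {K : Type} [Field K] [NumberField K]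
    (W : Submodule ℚ (bettiCohomology (Var.scheme hU h₃ (.pms c)) 1)) (ρ : K →ₐ[ℚ] Module.End ℚ W) (hW : W ≠ ⊥)
    (haon : ∀ σ : K →+* ℂ,
      (∀ t : ℂ ⊗[ℚ] W, (∀ a : K, (ρ a).baseChange ℂ t = (σ a : ℂ) • t) →
        IsOfHodgeType 2 (Var.scheme hU h₃ (.pms c)) 1 1 0
          (ofRatClassBaseChange (ComplexPoints (Var.scheme hU h₃ (.pms c))) 1 (W.subtype.baseChange ℂ t))) ∨
      (∀ t : ℂ ⊗[ℚ] W, (∀ a : K, (ρ a).baseChange ℂ t = (σ a : ℂ) • t) →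
        IsOfHodgeType 2 (Var.scheme hU h₃ (.pms c)) 1 0 1
          (ofRatClassBaseChange (ComplexPoints (Var.scheme hU h₃ (.pms c))) 1 (W.subtype.baseChange ℂ t)))) :
    ∃ Φ : CMType K,
      (∀ σ : K →+* ℂ, σ ∈ Φ.1 ↔
        ∀ t : ℂ ⊗[ℚ] W, (∀ a : K, (ρ a).baseChange ℂ t = (σ a : ℂ) • t) →
          IsOfHodgeType 2 (Var.scheme hU h₃ (.pms c)) 1 1 0
            (ofRatClassBaseChange (ComplexPoints (Var.scheme hU h₃ (.pms c))) 1 (W.subtype.baseChange ℂ t))) ∧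
      ∀ (A : AbelianVariety ℂ) (ι : 𝓞 K →+* End A) (θ : K →+* Module.End ℂ (complexBetti A.X 1))
        (_h : IsCMTypeRealisation Φ A ι θ) (_hθ : IsInducedOnIntegers θ),
        ∃ u : 𝒥.J ⟶ A, u ≠ 0 ∧
          (bettiCohomology.map (𝒥.abelJacobi P ≫ u.hom.hom.hom) 1).hom ≠ 0 ∧
          LinearMap.range (bettiCohomology.map (𝒥.abelJacobi P ≫ u.hom.hom.hom) 1).hom ≤ W :=
  𝒥.exists_cmType_hom_ne_zero_of_allOrNothing_submodule_of_finrank_le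
    (Var.ballDatum hU h₃ c h).isSmoothProjective P W ρ hW
    (finrank_bettiCohomology_le_two_mul_dim_pms c h 𝒥) haon

end Model

end Summit.HodgeConjecture.CorCM

end
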